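import Mathlib
import HarnessLib
import Summits.NavierStokesRegularity.NavierStokesRegularity.Theorems.LocalPressureProfileDoorPressureWindowToSlab

/-!
# LocalRuledPressureDoor — BC5 rung of crux `RuledPressureCollapse` (stmt-NavierStokesRegularity-27999): the lever, PROVED

Route `LocalRuledPressureDoor` (ns-idea-6 LINE g6-1 «ruled pressure»; planner ns-idea-6 g6, critic idea-crit-4 g5; DIRECTOR-NS #237 (1)
key ns-imp-p1 g4).  This is the planner's proved rung file `RuledPressureCollapse_rung.lean` (HOME lines/LocalRuledPressureDoor/,
evidence c1783ffcf32f89fa on 27999) landed VERBATIM modulo namespace/names: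

* `localRuledPressureDoor_ruledDecayVanish` = the birth skeleton's stub `stub_ruledDecayVanish` / `StubRuledDecayVanish` proved outright
  (a function on ℝ³ invariant under the shifts `y ↦ y + h • e`, `h ∈ [0, δ]`, `e ≠ 0`, `δ > 0`, and bounded by `K/(‖y‖+1)²` vanishes:
  iterate the shift `n` times and let `‖y + nδ e‖ → ∞`);
* `localRuledPressureDoor_ruledPressureCollapse_global` = the crux in the regime «the translation rule already holds at EVERY
  similarity position» (window = ℝ³), from the tree's apex pressure bound `abs_profilePressure_le`.

The remaining distance to the crux is exactly `stub_windowToEverywhere` (slice analyticity of the pressure gradient), landed separately.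
WHAT THIS IS NOT: a lemma about HYPOTHETICAL Type-I zoom profiles (criterion door «never pressureless»); not 0056, not the summit;
NS regularity OPEN / not proved.
-/

set_option linter.dupNamespace false

namespace Summit.NavierStokesRegularity.NavierStokesRegularity.Theorems

open scoped BigOperators Topology Classical InnerProductSpace RealInnerProductSpace
open Filter Set Function
open Literature.Analysis.FluidPDE
open Summit.NavierStokesRegularity.NavierStokesRegularity.Theorems.LocalPressureProfileDoorPressureWindowToSlab
  (abs_profilePressure_le)

/-- **The lever, proved**: a function on ℝ³ invariant under the shifts `y ↦ y + h • e`, `h ∈ [0, δ]` (`e ≠ 0`, `δ > 0`) and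
bounded by `K/(‖y‖+1)²` vanishes identically. -/
theorem localRuledPressureDoor_ruledDecayVanish (F : EuclideanSpace ℝ (Fin 3) → ℝ) (e : EuclideanSpace ℝ (Fin 3)) (he : e ≠ 0) (δ K : ℝ)
    (hδ : 0 < δ) (hrule : ∀ y, ∀ h ∈ Set.Icc (0 : ℝ) δ, F (y + h • e) = F y)
    (hdec : ∀ y, |F y| ≤ K / (‖y‖ + 1) ^ 2) : ∀ y, F y = 0 := by
  intro y
  have hiter : ∀ n : ℕ, F (y + ((n : ℝ) * δ) • e) = F y := by
    intro n
    induction n with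
    | zero => simp
    | succ n ih =>
      have h1 := hrule (y + ((n : ℝ) * δ) • e) δ ⟨hδ.le, le_rfl⟩
      rw [← ih, ← h1]
      congr 1
      rw [add_assoc, ← add_smul]
      push_cast
      ring_nf
  by_contra hne
  have hpos : 0 < |F y| := abs_pos.2 hne
  have he' : 0 < ‖e‖ := norm_pos_iff.2 he
  have hde : 0 < δ * ‖e‖ := mul_pos hδ he'
  obtain ⟨n, hn⟩ := exists_nat_gt ((‖y‖ + Real.sqrt (|K| / |F y|)) / (δ * ‖e‖))
  have hn' : ‖y‖ + Real.sqrt (|K| / |F y|) < (n : ℝ) * (δ * ‖e‖) := by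
    rwa [div_lt_iff₀ hde] at hn
  set w : EuclideanSpace ℝ (Fin 3) := y + ((n : ℝ) * δ) • e with hw
  have hnd : 0 ≤ (n : ℝ) * δ := mul_nonneg (Nat.cast_nonneg n) hδ.le
  have hnorm_smul : ‖((n : ℝ) * δ) • e‖ = (n : ℝ) * (δ * ‖e‖) := by
    rw [norm_smul, Real.norm_of_nonneg hnd, mul_assoc]
  have hwlow : (n : ℝ) * (δ * ‖e‖) - ‖y‖ ≤ ‖w‖ := by
    have h2 : ‖((n : ℝ) * δ) • e‖ ≤ ‖w‖ + ‖y‖ := by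
      have : ((n : ℝ) * δ) • e = w - y := by rw [hw]; abel
      rw [this]; exact norm_sub_le w y
    linarith [hnorm_smul ▸ h2]
  have hsq : Real.sqrt (|K| / |F y|) < ‖w‖ + 1 := by linarith
  have hw1 : 0 < ‖w‖ + 1 := by positivity
  have hbound : |F y| ≤ K / (‖w‖ + 1) ^ 2 := by simpa [hw, hiter n] using hdec w
  have hK : |F y| * (‖w‖ + 1) ^ 2 ≤ K := by
    rwa [le_div_iff₀ (by positivity)] at hbound
  -- from hsq: |K| / |F y| < (‖w‖+1)^2, i.e. |K| < |F y| (‖w‖+1)^2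
  have hsq0 : 0 ≤ Real.sqrt (|K| / |F y|) := Real.sqrt_nonneg _
  have h3 : |K| / |F y| < (‖w‖ + 1) ^ 2 := by
    have h4 : Real.sqrt (|K| / |F y|) ^ 2 < (‖w‖ + 1) ^ 2 := by
      exact pow_lt_pow_left₀ hsq hsq0 two_ne_zero
    rwa [Real.sq_sqrt (div_nonneg (abs_nonneg K) hpos.le)] at h4
  have h5 : |K| < |F y| * (‖w‖ + 1) ^ 2 := by
    rw [div_lt_iff₀ hpos] at h3; linarith
  linarith [le_abs_self K]

/-- **BC5 rung (proved special case of the crux)**: `RuledPressureCollapse` when the translation rule holds at every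
similarity position — the apex decay bound of the tree kills the ruled similarity pressure. -/
theorem localRuledPressureDoor_ruledPressureCollapse_global (C D : ℝ) (v : ℝ → EuclideanSpace ℝ (Fin 3) → EuclideanSpace ℝ (Fin 3))
    (_hrate : HasTypeITimeDecay C v) (hdec : HasTypeIDecay D v)
    (hcont : ContinuousOn (Function.uncurry v) (Set.Iio (0 : ℝ) ×ˢ Set.univ))
    (hmild : ∀ s t : ℝ, s < t → t < 0 → ∀ x, v t x = Literature.Analysis.UnboundedOperators.heatExtension (v s) (t - s) x
        - oseenDuhamel 1 s v v t x)
    (hdiv : ∀ t < 0, VectorCalculus.IsDivFree (v t)) (e : EuclideanSpace ℝ (Fin 3)) (he : e ≠ 0) (δ : ℝ) (hδ : 0 < δ)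
    (hrule : ∀ t < 0, ∀ y, ∀ h ∈ Set.Icc (0 : ℝ) δ,
        (-t) * pressurePotential (v t) (Real.sqrt (-t) • (y + h • e)) = (-t) * pressurePotential (v t) (Real.sqrt (-t) • y)) :
    ∀ t < 0, ∀ z : EuclideanSpace ℝ (Fin 3), pressurePotential (v t) z = 0 := by
  intro t ht z
  obtain ⟨K, hK0, hK⟩ := abs_profilePressure_le hdec hcont hmild hdiv
  have hzero := localRuledPressureDoor_ruledDecayVanish (fun y => (-t) * pressurePotential (v t) (Real.sqrt (-t) • y)) e he δ K hδ
    (hrule t ht) (fun y => hK t ht y)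
  have hs : 0 < Real.sqrt (-t) := Real.sqrt_pos.2 (neg_pos.2 ht)
  have h1 := hzero ((Real.sqrt (-t))⁻¹ • z)
  simp only [smul_smul, mul_inv_cancel₀ hs.ne', one_smul] at h1
  exact (mul_eq_zero.1 h1).resolve_left (neg_ne_zero.2 ht.ne)

end Summit.NavierStokesRegularity.NavierStokesRegularity.Theorems
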